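import Summits.ValiantsHypothesis.ValiantsHypothesis.Theorems.LacunarySymmetroidMatrixDescartesCensusWindowN
import Summits.ValiantsHypothesis.ValiantsHypothesis.Theorems.LacunarySymmetroidMatrixDescartesCensusTwistedRolleMult

/-!
# `MatrixDescartes` census — WINDOW ROOTS and the FLANK ROWS at a sign repetition (new exact rows for V = n − 2, n − 3)

HONEST FRAMING.  Object-search cell `pub-symmetroid`, route crux `Theses.LacunarySymmetroid.MatrixDescartes`
(ledger item stmt-ValiantsHypothesis-18050).  Elementary theorems about ONE real fewnomial `f = Σ_{t<n} c_t X^{e_t}`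
(`e` strictly increasing, all `c_t ≠ 0`), positive roots counted WITH MULTIPLICITY (`#Z₊^{mult} = roots.countP (0<·)`):

* `countP_posRoots_le_countP_twists` — killing any finite set `U` of exponents by Euler twists costs at most `#U`
  positive roots (iterated `countP_posRoots_le_countP_posRoots_twist_succ`);
* `exists_posRoot_window` — WINDOW ROOT LEMMA: if `#Z₊^{mult}(f) ≥ n − w + 1` then for every window of `w`
  consecutive terms the killed window polynomial `Σ_{t ∈ [i, i+w)} c_t P_t x^{e_t}`, `P_t = ∏_{u ∉ window} (e_t − e_u)`,
  has a positive root;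
* the FLANK ROWS (`flank_row_low`, `flank_row_high`) — NEW exact log-linear rows at a sign repetition: if
  `#Z₊^{mult}(f) ≥ n − 3` and four consecutive coefficients have the pattern `(−,+,−,−)` (isolated sign at `i+1`,
  repetition `(i+2, i+3)`), then the Newton row at the triple `(i, i+1, i+2)` holds with the REDUCED weights
  `w_t = ∏_{u ∉ {i,…,i+3}} |e_t − e_u|` (AM–GM form `(a+b)^{a+b} (|c_i| w_i)^b (|c_{i+2}| w_{i+2})^a ≤ (|c_{i+1}| w_{i+1})^{a+b} a^a b^b`,
  `a = e_{i+1} − e_i`, `b = e_{i+2} − e_{i+1}`), i.e. THEOREM N″'s row at that triple with every weight `W_t` divided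
  by `|e_t − e_{i+3}|` — STRICTLY STRONGER than the one-slack lemma's flank row (by the concavity of `log (e_{i+3} − ·)`
  the dropped factors favour the centre), and valid one slack LOWER (`n − 3`, e.g. the census `(2,6)` eighteens:
  21 terms, 18 roots); mirror pattern `(+,+,−,+)` gives the row at `(i+1, i+2, i+3)` with `u = i` dropped;
  `window_balance_mid` — pattern `(−,+,+,−)`: `|c_i| w_i y_i + |c_{i+3}| w_{i+3} y_{i+3} = |c_{i+1}| w_{i+1} y_{i+1} + |c_{i+2}| w_{i+2} y_{i+2}`
  at some `y_t = x^{e_t}`, `x > 0` (an exact one-dimensional feasibility condition ACROSS the repetition).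
  PROOF: kill the `n − 4` terms outside the window (cost ≤ 1 each), take a positive root of the 4-nomial, read the
  vanishing as «isolated term = sum of the three others», apply weighted AM–GM to two of them.
Located exact check (`flank_check.py`, HOME/census/records): the flank rows hold on every applicable census row —
(2,4) 162/162, (2,5) 296/296, (3,4) 76/76, (2,6) eighteens 2 160/2 160 — tighter than N″ at the same triple by a
median ≈ 0.13 nats per unit gap.  NECESSARY conditions only; no bound on `ζ_sym`, nothing on `DoorA26`/`DoorA34`
(OPEN), the crux, or `VP ≠ VNP`.

[folklore] Rolle with multiplicity + weighted AM–GM; the flank-row observation is the cell's (engine-6 g17). -/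

-- `Summit.ValiantsHypothesis.ValiantsHypothesis.…` repeats a component by the D-0017 layout
-- (single-conjunct summit), which the `dupNamespace` linter flags; the name is mandated.
set_option linter.dupNamespace false

namespace Summit.ValiantsHypothesis.ValiantsHypothesis.Theorems.LacunarySymmetroidMatrixDescartes.Census

open Polynomial Finset
open scoped BigOperators Polynomial

/-! ### Killing a set of exponents -/

/-- **Iterated twisted Rolle, with multiplicity.**  Killing the exponents `e u`, `u ∈ U`, one Euler twist at a time
turns `Σ_{t<n} c_t X^{e_t}` into `Σ_{t<n} c_t (∏_{u∈U} (e_t − e_u)) X^{e_t}` (the terms `t ∈ U` vanish) and loses at most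
`#U` positive roots counted with multiplicity. [folklore] -/
theorem countP_posRoots_le_countP_twists (n : ℕ) (e : ℕ → ℕ) (c : ℕ → ℝ) (U : Finset ℕ) :
    (∑ t ∈ range n, C (c t) * X ^ (e t) : ℝ[X]).roots.countP (fun x => 0 < x) ≤
      (∑ t ∈ range n, C (c t * ∏ u ∈ U, ((e t : ℝ) - e u)) * X ^ (e t) : ℝ[X]).roots.countP (fun x => 0 < x)
        + U.card := by
  classical
  induction U using Finset.induction_on with
  | empty => simp
  | insert u U hu ih =>
    rw [Finset.card_insert_of_notMem hu]
    have step := countP_posRoots_le_countP_posRoots_twist_succ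
      (∑ t ∈ range n, C (c t * ∏ u' ∈ U, ((e t : ℝ) - e u')) * X ^ (e t) : ℝ[X]) (e u)
    rw [twist_rsum] at step
    have hsum : (∑ t ∈ range n, C (c t * (∏ u' ∈ U, ((e t : ℝ) - e u')) * ((e t : ℝ) - e u)) * X ^ (e t) : ℝ[X])
        = ∑ t ∈ range n, C (c t * ∏ u' ∈ insert u U, ((e t : ℝ) - e u')) * X ^ (e t) := by
      refine Finset.sum_congr rfl fun t _ => ?_
      rw [Finset.prod_insert hu]
      ring_nf
    rw [hsum] at step
    omega

/-! ### The window root lemma -/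

/-- **WINDOW ROOT LEMMA.**  Let `f = Σ_{t<n} c_t X^{e_t}` have at least `n − w + 1` positive roots counted with
multiplicity (`1 ≤ w`, `i + w ≤ n`).  Then the window polynomial obtained by killing every exponent outside
`[i, i+w)`, namely `Q = Σ_{t ∈ [i,i+w)} c_t P_t X^{e_t}` with `P_t = ∏_{u<n, u∉[i,i+w)} (e_t − e_u)`, has a positive root:
`∃ x > 0, Σ_{t∈[i,i+w)} c_t P_t x^{e_t} = 0`. [folklore] -/
theorem exists_posRoot_window {n w i : ℕ} (hw : 1 ≤ w) (hiw : i + w ≤ n) (e : ℕ → ℕ) (c : ℕ → ℝ)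
    (hZ : n - w + 1 ≤ (∑ t ∈ range n, C (c t) * X ^ (e t) : ℝ[X]).roots.countP (fun x => 0 < x)) :
    ∃ x : ℝ, 0 < x ∧
      ∑ t ∈ Ico i (i + w), c t * (∏ u ∈ (range n).filter (fun u => u < i ∨ i + w ≤ u), ((e t : ℝ) - e u)) * x ^ (e t)
        = 0 := by
  classical
  set U := (range n).filter (fun u => u < i ∨ i + w ≤ u) with hU
  have hUcard : U.card = n - w := by
    have hsplit : U = range i ∪ Ico (i + w) n := by
      ext u
      simp only [hU, Finset.mem_filter, Finset.mem_range, Finset.mem_union, Finset.mem_Ico]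
      omega
    rw [hsplit, Finset.card_union_of_disjoint, Finset.card_range, Nat.card_Ico]
    · omega
    · rw [Finset.disjoint_left]
      intro u hu1 hu2
      rw [Finset.mem_range] at hu1
      rw [Finset.mem_Ico] at hu2
      omega
  set Q : ℝ[X] := ∑ t ∈ range n, C (c t * ∏ u ∈ U, ((e t : ℝ) - e u)) * X ^ (e t) with hQ
  have hkill := countP_posRoots_le_countP_twists n e c U
  rw [hUcard] at hkill
  have hQpos : 0 < Q.roots.countP (fun x => 0 < x) := by rw [hQ]; omega
  obtain ⟨x, hxmem, hxpos⟩ := Multiset.countP_pos.mp hQpos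
  have hQ0 : Q ≠ 0 := by
    intro h0; rw [h0, roots_zero] at hxmem; simp at hxmem
  have hroot : Q.eval x = 0 := (mem_roots hQ0).mp hxmem
  refine ⟨x, hxpos, ?_⟩
  -- `Q.eval x` is the window sum: terms `t ∈ U` vanish
  have heval : Q.eval x = ∑ t ∈ range n, c t * (∏ u ∈ U, ((e t : ℝ) - e u)) * x ^ (e t) := by
    rw [hQ, eval_finsetSum]
    refine Finset.sum_congr rfl fun t _ => ?_
    rw [eval_mul, eval_C, eval_pow, eval_X]
  have hvanish : ∀ t ∈ range n, t ∉ Ico i (i + w) → c t * (∏ u ∈ U, ((e t : ℝ) - e u)) * x ^ (e t) = 0 := by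
    intro t ht hnot
    have htU : t ∈ U := by
      rw [hU, Finset.mem_filter]
      refine ⟨ht, ?_⟩
      rw [Finset.mem_Ico] at hnot
      omega
    rw [Finset.prod_eq_zero htU (sub_self _), mul_zero, zero_mul]
  have hsub : Ico i (i + w) ⊆ range n := by
    intro t ht
    rw [Finset.mem_Ico] at ht
    exact Finset.mem_range.mpr (by omega)
  rw [Finset.sum_subset hsub hvanish, ← heval]
  exact hroot

/-! ### The flank rows at a sign repetition -/

/-- Three reals of one sign: `|u + v + w| = |u| + |v| + |w|`. [folklore] -/
theorem abs_add_add_of_same_sign {u v w : ℝ} (huv : 0 < u * v) (hvw : 0 < v * w) :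
    |u + v + w| = |u| + |v| + |w| := by
  rcases lt_or_gt_of_ne (show v ≠ 0 from fun h => by rw [h, mul_zero] at huv; exact lt_irrefl 0 huv) with hv | hv
  · have hu : u < 0 := by nlinarith
    have hw : w < 0 := by nlinarith
    rw [abs_of_neg hu, abs_of_neg hv, abs_of_neg hw, abs_of_neg (by linarith)]; ring
  · have hu : 0 < u := by nlinarith
    have hw : 0 < w := by nlinarith
    rw [abs_of_pos hu, abs_of_pos hv, abs_of_pos hw, abs_of_pos (by linarith)]

/-- Kill-products at two window indices have a positive product (every killed exponent lies on the same side of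
both). [folklore] -/
theorem prod_kill_mul_prod_kill_pos {n w i : ℕ} (e : ℕ → ℕ) (he : StrictMono e) {s t : ℕ}
    (hs : i ≤ s) (hs' : s < i + w) (ht : i ≤ t) (ht' : t < i + w) :
    0 < (∏ u ∈ (range n).filter (fun u => u < i ∨ i + w ≤ u), ((e s : ℝ) - e u)) *
        (∏ u ∈ (range n).filter (fun u => u < i ∨ i + w ≤ u), ((e t : ℝ) - e u)) := by
  rw [← Finset.prod_mul_distrib]
  refine Finset.prod_pos fun u hu => ?_
  rw [Finset.mem_filter] at hu
  rcases hu.2 with hlt | hge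
  · have h1 : (e u : ℝ) < e s := by exact_mod_cast he (by omega)
    have h2 : (e u : ℝ) < e t := by exact_mod_cast he (by omega)
    nlinarith
  · have h1 : (e s : ℝ) < e u := by exact_mod_cast he (by omega)
    have h2 : (e t : ℝ) < e u := by exact_mod_cast he (by omega)
    nlinarith

/-- From a two-term lower bound `A·x⁻ᵃ + C·xᵇ ≤ B` at one point `x > 0` to the trinomial row
`(a+b)^{a+b} A^b C^a ≤ B^{a+b} a^a b^b` (weighted AM–GM, `amgm_pow_nat`). [folklore] -/
theorem row_of_two_term_le {a b : ℕ} (ha : 0 < a) (hb : 0 < b) {A B Cc x : ℝ} (hA : 0 ≤ A) (hC : 0 ≤ Cc)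
    (hx : 0 < x) (hle : A * x⁻¹ ^ a + Cc * x ^ b ≤ B) :
    ((a : ℝ) + b) ^ (a + b) * A ^ b * Cc ^ a ≤ B ^ (a + b) * (a : ℝ) ^ a * (b : ℝ) ^ b := by
  have hPge : 0 ≤ A * x⁻¹ ^ a := by positivity
  have hQge : 0 ≤ Cc * x ^ b := by positivity
  have am := amgm_pow_nat ha hb hPge hQge
  have hone : (x⁻¹ ^ a) ^ b * (x ^ b) ^ a = 1 := by
    rw [← pow_mul, ← pow_mul, mul_comm b a, ← mul_pow, inv_mul_cancel₀ hx.ne', one_pow]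
  have hprod : (A * x⁻¹ ^ a) ^ b * (Cc * x ^ b) ^ a = A ^ b * Cc ^ a := by
    calc (A * x⁻¹ ^ a) ^ b * (Cc * x ^ b) ^ a = A ^ b * Cc ^ a * ((x⁻¹ ^ a) ^ b * (x ^ b) ^ a) := by ring
      _ = A ^ b * Cc ^ a := by rw [hone, mul_one]
  have hmono : (A * x⁻¹ ^ a + Cc * x ^ b) ^ (a + b) ≤ B ^ (a + b) :=
    pow_le_pow_left₀ (by positivity) hle _
  calc ((a : ℝ) + b) ^ (a + b) * A ^ b * Cc ^ a
      = ((a : ℝ) + b) ^ (a + b) * (A * x⁻¹ ^ a) ^ b * (Cc * x ^ b) ^ a := by rw [mul_assoc, ← hprod, ← mul_assoc]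
    _ ≤ (A * x⁻¹ ^ a + Cc * x ^ b) ^ (a + b) * (a : ℝ) ^ a * (b : ℝ) ^ b := am
    _ ≤ B ^ (a + b) * (a : ℝ) ^ a * (b : ℝ) ^ b := by gcongr

/-- The killed 4-window of `f`, evaluated: under `#Z₊^{mult}(f) ≥ n − 3` there is `x > 0` with
`Σ_{t=i}^{i+3} c_t P_t x^{e_t} = 0`, `P_t = ∏_{u ∉ window} (e_t − e_u)`, written out term by term. [folklore] -/
theorem exists_posRoot_window_four {n i : ℕ} (hi : i + 4 ≤ n) (e : ℕ → ℕ) (c : ℕ → ℝ)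
    (hZ : n - 3 ≤ (∑ t ∈ range n, C (c t) * X ^ (e t) : ℝ[X]).roots.countP (fun x => 0 < x)) :
    ∃ x : ℝ, 0 < x ∧
      c i * (∏ u ∈ (range n).filter (fun u => u < i ∨ i + 4 ≤ u), ((e i : ℝ) - e u)) * x ^ e i
      + c (i + 1) * (∏ u ∈ (range n).filter (fun u => u < i ∨ i + 4 ≤ u), ((e (i + 1) : ℝ) - e u)) * x ^ e (i + 1)
      + c (i + 2) * (∏ u ∈ (range n).filter (fun u => u < i ∨ i + 4 ≤ u), ((e (i + 2) : ℝ) - e u)) * x ^ e (i + 2)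
      + c (i + 3) * (∏ u ∈ (range n).filter (fun u => u < i ∨ i + 4 ≤ u), ((e (i + 3) : ℝ) - e u)) * x ^ e (i + 3)
        = 0 := by
  obtain ⟨x, hx, hroot⟩ := exists_posRoot_window (w := 4) (i := i) (by norm_num) hi e c (by omega)
  rw [show i + 4 = i + 1 + 1 + 1 + 1 by ring, Finset.sum_Ico_succ_top (by omega), Finset.sum_Ico_succ_top (by omega),
    Finset.sum_Ico_succ_top (by omega), Nat.Ico_succ_singleton, Finset.sum_singleton] at hroot
  simp only [show i + 1 + 1 = i + 2 by ring, show i + 1 + 1 + 1 = i + 3 by ring] at hroot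
  exact ⟨x, hx, hroot⟩

/-- **FLANK BALANCE (low side of a repetition).**  Let `f = Σ_{t<n} c_t X^{e_t}` (`e` strictly increasing) have at
least `n − 3` positive roots counted with multiplicity, and let `c_i c_{i+1} < 0`, `c_{i+1} c_{i+2} < 0`,
`c_{i+2} c_{i+3} > 0` (pattern `(−,+,−,−)`: isolated sign at `i+1`, repetition `(i+2, i+3)`).  Then for some
`x > 0`, with `w_t = ∏_{u<n, u∉{i,…,i+3}} |e_t − e_u|`:
`|c_{i+1}| w_{i+1} x^{e_{i+1}} = |c_i| w_i x^{e_i} + |c_{i+2}| w_{i+2} x^{e_{i+2}} + |c_{i+3}| w_{i+3} x^{e_{i+3}}`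
— the isolated term balances the other three (exact one-dimensional condition; its log-linear shadows are the
weighted AM–GM rows `|c_{i+1}| w_{i+1} ≥ (|c_i|w_i/α)^α (|c_{i+2}|w_{i+2}/β)^β (|c_{i+3}|w_{i+3}/γ)^γ` for every
`α+β+γ = 1`, `α e_i + β e_{i+2} + γ e_{i+3} = e_{i+1}`; `γ = 0` is `flank_row_low`). [folklore] -/
theorem flank_balance_low {n i : ℕ} (hi : i + 4 ≤ n) (e : ℕ → ℕ) (he : StrictMono e) (c : ℕ → ℝ)
    (hZ : n - 3 ≤ (∑ t ∈ range n, C (c t) * X ^ (e t) : ℝ[X]).roots.countP (fun x => 0 < x))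
    (h1 : c i * c (i + 1) < 0) (h2 : c (i + 1) * c (i + 2) < 0) (h3 : 0 < c (i + 2) * c (i + 3)) :
    ∃ x : ℝ, 0 < x ∧
      |c (i + 1)| * (∏ u ∈ (range n).filter (fun u => u < i ∨ i + 4 ≤ u), |(e (i + 1) : ℝ) - e u|) * x ^ e (i + 1)
        = |c i| * (∏ u ∈ (range n).filter (fun u => u < i ∨ i + 4 ≤ u), |(e i : ℝ) - e u|) * x ^ e i
          + |c (i + 2)| * (∏ u ∈ (range n).filter (fun u => u < i ∨ i + 4 ≤ u), |(e (i + 2) : ℝ) - e u|) * x ^ e (i + 2)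
          + |c (i + 3)| * (∏ u ∈ (range n).filter (fun u => u < i ∨ i + 4 ≤ u), |(e (i + 3) : ℝ) - e u|) * x ^ e (i + 3) := by
  classical
  set U := (range n).filter (fun u => u < i ∨ i + 4 ≤ u) with hU
  set P : ℕ → ℝ := fun t => ∏ u ∈ U, ((e t : ℝ) - e u) with hP
  have hPabs : ∀ t, |P t| = ∏ u ∈ U, |(e t : ℝ) - e u| := fun t => by rw [hP]; exact Finset.abs_prod _ _
  obtain ⟨x, hx, hroot⟩ := exists_posRoot_window_four hi e c hZ
  change c i * P i * x ^ e i + c (i + 1) * P (i + 1) * x ^ e (i + 1) + c (i + 2) * P (i + 2) * x ^ e (i + 2)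
    + c (i + 3) * P (i + 3) * x ^ e (i + 3) = 0 at hroot
  have hPP02 : 0 < P i * P (i + 2) := prod_kill_mul_prod_kill_pos (w := 4) e he le_rfl (by omega) (by omega) (by omega)
  have hPP23 : 0 < P (i + 2) * P (i + 3) :=
    prod_kill_mul_prod_kill_pos (w := 4) e he (by omega) (by omega) (by omega) (by omega)
  have hc02 : 0 < c i * c (i + 2) := by
    have : 0 < (c i * c (i + 1)) * (c (i + 1) * c (i + 2)) := mul_pos_of_neg_of_neg h1 h2
    nlinarith [sq_nonneg (c (i + 1))]
  have hy : ∀ k, 0 < x ^ (e k) := fun k => pow_pos hx _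
  have hs1 : 0 < (c i * P i * x ^ e i) * (c (i + 2) * P (i + 2) * x ^ e (i + 2)) := by
    have := mul_pos (mul_pos hc02 hPP02) (mul_pos (hy i) (hy (i + 2))); linarith
  have hs2 : 0 < (c (i + 2) * P (i + 2) * x ^ e (i + 2)) * (c (i + 3) * P (i + 3) * x ^ e (i + 3)) := by
    have := mul_pos (mul_pos h3 hPP23) (mul_pos (hy (i + 2)) (hy (i + 3))); linarith
  have hiso : c (i + 1) * P (i + 1) * x ^ e (i + 1)
      = -(c i * P i * x ^ e i + c (i + 2) * P (i + 2) * x ^ e (i + 2) + c (i + 3) * P (i + 3) * x ^ e (i + 3)) := by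
    linarith
  have habs := congrArg (fun r : ℝ => |r|) hiso
  simp only [abs_neg] at habs
  rw [abs_add_add_of_same_sign hs1 hs2] at habs
  refine ⟨x, hx, ?_⟩
  rw [← hPabs i, ← hPabs (i + 1), ← hPabs (i + 2), ← hPabs (i + 3)]
  simpa only [abs_mul, abs_of_pos (hy _)] using habs

/-- **FLANK ROW (low side of a repetition) — a new exact row.**  Under the hypotheses of `flank_balance_low`, with the
REDUCED weights `w_t = ∏_{u<n, u∉{i,…,i+3}} |e_t − e_u|`, `a = e_{i+1} − e_i`, `b = e_{i+2} − e_{i+1}`: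
`(a+b)^{a+b} · (|c_i| w_i)^b · (|c_{i+2}| w_{i+2})^a ≤ (|c_{i+1}| w_{i+1})^{a+b} · a^a · b^b`
— THEOREM N″'s row at `(i, i+1, i+2)` with each weight `W_t` divided by `|e_t − e_{i+3}|`, hence STRICTLY STRONGER
(`(e_{i+3} − e_i)^b (e_{i+3} − e_{i+2})^a ≤ (e_{i+3} − e_{i+1})^{a+b}` by concavity), and valid under
`#Z₊^{mult} ≥ n − 3`. [folklore] -/
theorem flank_row_low {n i : ℕ} (hi : i + 4 ≤ n) (e : ℕ → ℕ) (he : StrictMono e) (c : ℕ → ℝ)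
    (hZ : n - 3 ≤ (∑ t ∈ range n, C (c t) * X ^ (e t) : ℝ[X]).roots.countP (fun x => 0 < x))
    (h1 : c i * c (i + 1) < 0) (h2 : c (i + 1) * c (i + 2) < 0) (h3 : 0 < c (i + 2) * c (i + 3)) :
    (((e (i + 1) - e i : ℕ) : ℝ) + ((e (i + 2) - e (i + 1) : ℕ) : ℝ)) ^ (e (i + 1) - e i + (e (i + 2) - e (i + 1))) *
        (|c i| * ∏ u ∈ (range n).filter (fun u => u < i ∨ i + 4 ≤ u), |(e i : ℝ) - e u|) ^ (e (i + 2) - e (i + 1)) *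
        (|c (i + 2)| * ∏ u ∈ (range n).filter (fun u => u < i ∨ i + 4 ≤ u), |(e (i + 2) : ℝ) - e u|) ^ (e (i + 1) - e i)
      ≤ (|c (i + 1)| * ∏ u ∈ (range n).filter (fun u => u < i ∨ i + 4 ≤ u), |(e (i + 1) : ℝ) - e u|)
          ^ (e (i + 1) - e i + (e (i + 2) - e (i + 1))) *
        ((e (i + 1) - e i : ℕ) : ℝ) ^ (e (i + 1) - e i) * ((e (i + 2) - e (i + 1) : ℕ) : ℝ) ^ (e (i + 2) - e (i + 1)) := by
  obtain ⟨x, hx, hbal⟩ := flank_balance_low hi e he c hZ h1 h2 h3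
  set wA := ∏ u ∈ (range n).filter (fun u => u < i ∨ i + 4 ≤ u), |(e i : ℝ) - e u|
  set wB := ∏ u ∈ (range n).filter (fun u => u < i ∨ i + 4 ≤ u), |(e (i + 1) : ℝ) - e u|
  set wC := ∏ u ∈ (range n).filter (fun u => u < i ∨ i + 4 ≤ u), |(e (i + 2) : ℝ) - e u|
  set wD := ∏ u ∈ (range n).filter (fun u => u < i ∨ i + 4 ≤ u), |(e (i + 3) : ℝ) - e u|
  set a := e (i + 1) - e i with ha
  set b := e (i + 2) - e (i + 1) with hb
  have hei1 : e i < e (i + 1) := he (by omega)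
  have hei2 : e (i + 1) < e (i + 2) := he (by omega)
  have hy : ∀ k, 0 < x ^ (e k) := fun k => pow_pos hx _
  have hwD : 0 ≤ wD := Finset.prod_nonneg fun _ _ => abs_nonneg _
  have hAterm : |c i| * wA * x ^ e i = (|c i| * wA * x⁻¹ ^ a) * x ^ e (i + 1) := by
    rw [show e (i + 1) = e i + a by omega, pow_add, inv_pow]
    field_simp
  have hCterm : |c (i + 2)| * wC * x ^ e (i + 2) = (|c (i + 2)| * wC * x ^ b) * x ^ e (i + 1) := by
    rw [show e (i + 2) = e (i + 1) + b by omega, pow_add]; ring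
  have hD : 0 ≤ |c (i + 3)| * wD * x ^ e (i + 3) := by positivity
  have hkey : |c i| * wA * x⁻¹ ^ a + |c (i + 2)| * wC * x ^ b ≤ |c (i + 1)| * wB := by
    have hle : (|c i| * wA * x⁻¹ ^ a + |c (i + 2)| * wC * x ^ b) * x ^ e (i + 1)
        ≤ (|c (i + 1)| * wB) * x ^ e (i + 1) := by
      rw [add_mul, ← hAterm, ← hCterm, hbal]; linarith
    exact le_of_mul_le_mul_right hle (hy (i + 1))
  exact row_of_two_term_le (by omega) (by omega) (by positivity) (by positivity) hx hkey

/-- **FLANK BALANCE (high side of a repetition).**  Mirror of `flank_balance_low`: pattern `(+,+,−,+)`,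
`c_i c_{i+1} > 0`, `c_{i+1} c_{i+2} < 0`, `c_{i+2} c_{i+3} < 0` (repetition `(i, i+1)`, isolated sign at `i+2`):
`|c_{i+2}| w_{i+2} x^{e_{i+2}} = |c_i| w_i x^{e_i} + |c_{i+1}| w_{i+1} x^{e_{i+1}} + |c_{i+3}| w_{i+3} x^{e_{i+3}}` for some
`x > 0`. [folklore] -/
theorem flank_balance_high {n i : ℕ} (hi : i + 4 ≤ n) (e : ℕ → ℕ) (he : StrictMono e) (c : ℕ → ℝ)
    (hZ : n - 3 ≤ (∑ t ∈ range n, C (c t) * X ^ (e t) : ℝ[X]).roots.countP (fun x => 0 < x))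
    (h1 : 0 < c i * c (i + 1)) (h2 : c (i + 1) * c (i + 2) < 0) (h3 : c (i + 2) * c (i + 3) < 0) :
    ∃ x : ℝ, 0 < x ∧
      |c (i + 2)| * (∏ u ∈ (range n).filter (fun u => u < i ∨ i + 4 ≤ u), |(e (i + 2) : ℝ) - e u|) * x ^ e (i + 2)
        = |c i| * (∏ u ∈ (range n).filter (fun u => u < i ∨ i + 4 ≤ u), |(e i : ℝ) - e u|) * x ^ e i
          + |c (i + 1)| * (∏ u ∈ (range n).filter (fun u => u < i ∨ i + 4 ≤ u), |(e (i + 1) : ℝ) - e u|) * x ^ e (i + 1)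
          + |c (i + 3)| * (∏ u ∈ (range n).filter (fun u => u < i ∨ i + 4 ≤ u), |(e (i + 3) : ℝ) - e u|) * x ^ e (i + 3) := by
  classical
  set U := (range n).filter (fun u => u < i ∨ i + 4 ≤ u) with hU
  set P : ℕ → ℝ := fun t => ∏ u ∈ U, ((e t : ℝ) - e u) with hP
  have hPabs : ∀ t, |P t| = ∏ u ∈ U, |(e t : ℝ) - e u| := fun t => by rw [hP]; exact Finset.abs_prod _ _
  obtain ⟨x, hx, hroot⟩ := exists_posRoot_window_four hi e c hZ
  change c i * P i * x ^ e i + c (i + 1) * P (i + 1) * x ^ e (i + 1) + c (i + 2) * P (i + 2) * x ^ e (i + 2)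
    + c (i + 3) * P (i + 3) * x ^ e (i + 3) = 0 at hroot
  have hPP01 : 0 < P i * P (i + 1) := prod_kill_mul_prod_kill_pos (w := 4) e he le_rfl (by omega) (by omega) (by omega)
  have hPP13 : 0 < P (i + 1) * P (i + 3) :=
    prod_kill_mul_prod_kill_pos (w := 4) e he (by omega) (by omega) (by omega) (by omega)
  have hc13 : 0 < c (i + 1) * c (i + 3) := by
    have : 0 < (c (i + 1) * c (i + 2)) * (c (i + 2) * c (i + 3)) := mul_pos_of_neg_of_neg h2 h3
    nlinarith [sq_nonneg (c (i + 2))]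
  have hy : ∀ k, 0 < x ^ (e k) := fun k => pow_pos hx _
  have hs1 : 0 < (c i * P i * x ^ e i) * (c (i + 1) * P (i + 1) * x ^ e (i + 1)) := by
    have := mul_pos (mul_pos h1 hPP01) (mul_pos (hy i) (hy (i + 1))); linarith
  have hs2 : 0 < (c (i + 1) * P (i + 1) * x ^ e (i + 1)) * (c (i + 3) * P (i + 3) * x ^ e (i + 3)) := by
    have := mul_pos (mul_pos hc13 hPP13) (mul_pos (hy (i + 1)) (hy (i + 3))); linarith
  have hiso : c (i + 2) * P (i + 2) * x ^ e (i + 2)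
      = -(c i * P i * x ^ e i + c (i + 1) * P (i + 1) * x ^ e (i + 1) + c (i + 3) * P (i + 3) * x ^ e (i + 3)) := by
    linarith
  have habs := congrArg (fun r : ℝ => |r|) hiso
  simp only [abs_neg] at habs
  rw [abs_add_add_of_same_sign hs1 hs2] at habs
  refine ⟨x, hx, ?_⟩
  rw [← hPabs i, ← hPabs (i + 1), ← hPabs (i + 2), ← hPabs (i + 3)]
  simpa only [abs_mul, abs_of_pos (hy _)] using habs

/-- **FLANK ROW (high side of a repetition).**  Under the hypotheses of `flank_balance_high`, with
`w_t = ∏_{u<n, u∉{i,…,i+3}} |e_t − e_u|`, `a = e_{i+2} − e_{i+1}`, `b = e_{i+3} − e_{i+2}`: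
`(a+b)^{a+b} · (|c_{i+1}| w_{i+1})^b · (|c_{i+3}| w_{i+3})^a ≤ (|c_{i+2}| w_{i+2})^{a+b} · a^a · b^b`
— THEOREM N″'s row at `(i+1, i+2, i+3)` with each weight divided by `|e_t − e_i|`. [folklore] -/
theorem flank_row_high {n i : ℕ} (hi : i + 4 ≤ n) (e : ℕ → ℕ) (he : StrictMono e) (c : ℕ → ℝ)
    (hZ : n - 3 ≤ (∑ t ∈ range n, C (c t) * X ^ (e t) : ℝ[X]).roots.countP (fun x => 0 < x))
    (h1 : 0 < c i * c (i + 1)) (h2 : c (i + 1) * c (i + 2) < 0) (h3 : c (i + 2) * c (i + 3) < 0) :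
    (((e (i + 2) - e (i + 1) : ℕ) : ℝ) + ((e (i + 3) - e (i + 2) : ℕ) : ℝ)) ^ (e (i + 2) - e (i + 1) + (e (i + 3) - e (i + 2))) *
        (|c (i + 1)| * ∏ u ∈ (range n).filter (fun u => u < i ∨ i + 4 ≤ u), |(e (i + 1) : ℝ) - e u|) ^ (e (i + 3) - e (i + 2)) *
        (|c (i + 3)| * ∏ u ∈ (range n).filter (fun u => u < i ∨ i + 4 ≤ u), |(e (i + 3) : ℝ) - e u|) ^ (e (i + 2) - e (i + 1))
      ≤ (|c (i + 2)| * ∏ u ∈ (range n).filter (fun u => u < i ∨ i + 4 ≤ u), |(e (i + 2) : ℝ) - e u|)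
          ^ (e (i + 2) - e (i + 1) + (e (i + 3) - e (i + 2))) *
        ((e (i + 2) - e (i + 1) : ℕ) : ℝ) ^ (e (i + 2) - e (i + 1)) * ((e (i + 3) - e (i + 2) : ℕ) : ℝ) ^ (e (i + 3) - e (i + 2)) := by
  obtain ⟨x, hx, hbal⟩ := flank_balance_high hi e he c hZ h1 h2 h3
  set wA := ∏ u ∈ (range n).filter (fun u => u < i ∨ i + 4 ≤ u), |(e i : ℝ) - e u|
  set wB := ∏ u ∈ (range n).filter (fun u => u < i ∨ i + 4 ≤ u), |(e (i + 1) : ℝ) - e u|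
  set wC := ∏ u ∈ (range n).filter (fun u => u < i ∨ i + 4 ≤ u), |(e (i + 2) : ℝ) - e u|
  set wD := ∏ u ∈ (range n).filter (fun u => u < i ∨ i + 4 ≤ u), |(e (i + 3) : ℝ) - e u|
  set a := e (i + 2) - e (i + 1) with ha
  set b := e (i + 3) - e (i + 2) with hb
  have hei1 : e (i + 1) < e (i + 2) := he (by omega)
  have hei2 : e (i + 2) < e (i + 3) := he (by omega)
  have hy : ∀ k, 0 < x ^ (e k) := fun k => pow_pos hx _
  have hwD : 0 ≤ wD := Finset.prod_nonneg fun _ _ => abs_nonneg _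
  have hBterm : |c (i + 1)| * wB * x ^ e (i + 1) = (|c (i + 1)| * wB * x⁻¹ ^ a) * x ^ e (i + 2) := by
    rw [show e (i + 2) = e (i + 1) + a by omega, pow_add, inv_pow]
    field_simp
  have hDterm : |c (i + 3)| * wD * x ^ e (i + 3) = (|c (i + 3)| * wD * x ^ b) * x ^ e (i + 2) := by
    rw [show e (i + 3) = e (i + 2) + b by omega, pow_add]; ring
  have hA : 0 ≤ |c i| * wA * x ^ e i := by positivity
  have hkey : |c (i + 1)| * wB * x⁻¹ ^ a + |c (i + 3)| * wD * x ^ b ≤ |c (i + 2)| * wC := by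
    have hle : (|c (i + 1)| * wB * x⁻¹ ^ a + |c (i + 3)| * wD * x ^ b) * x ^ e (i + 2)
        ≤ (|c (i + 2)| * wC) * x ^ e (i + 2) := by
      rw [add_mul, ← hBterm, ← hDterm, hbal]; linarith
    exact le_of_mul_le_mul_right hle (hy (i + 2))
  exact row_of_two_term_le (by omega) (by omega) (by positivity) (by positivity) hx hkey

/-- **WINDOW BALANCE through a repetition.**  Let `f = Σ_{t<n} c_t X^{e_t}` (`e` strictly increasing) have at least
`n − 3` positive roots counted with multiplicity, and let four consecutive coefficients have the pattern `(−,+,+,−)`: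
`c_i c_{i+1} < 0`, `c_{i+1} c_{i+2} > 0`, `c_{i+2} c_{i+3} < 0` (the repetition in the middle).  Then for some `x > 0`,
with `w_t = ∏_{u<n, u∉{i,…,i+3}} |e_t − e_u|`:
`|c_i| w_i x^{e_i} + |c_{i+3}| w_{i+3} x^{e_{i+3}} = |c_{i+1}| w_{i+1} x^{e_{i+1}} + |c_{i+2}| w_{i+2} x^{e_{i+2}}`
— an exact one-dimensional feasibility condition tying the two sides of the repetition. [folklore] -/
theorem window_balance_mid {n i : ℕ} (hi : i + 4 ≤ n) (e : ℕ → ℕ) (he : StrictMono e) (c : ℕ → ℝ)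
    (hZ : n - 3 ≤ (∑ t ∈ range n, C (c t) * X ^ (e t) : ℝ[X]).roots.countP (fun x => 0 < x))
    (h1 : c i * c (i + 1) < 0) (h2 : 0 < c (i + 1) * c (i + 2)) (h3 : c (i + 2) * c (i + 3) < 0) :
    ∃ x : ℝ, 0 < x ∧
      |c i| * (∏ u ∈ (range n).filter (fun u => u < i ∨ i + 4 ≤ u), |(e i : ℝ) - e u|) * x ^ (e i)
        + |c (i + 3)| * (∏ u ∈ (range n).filter (fun u => u < i ∨ i + 4 ≤ u), |(e (i + 3) : ℝ) - e u|) * x ^ (e (i + 3))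
      = |c (i + 1)| * (∏ u ∈ (range n).filter (fun u => u < i ∨ i + 4 ≤ u), |(e (i + 1) : ℝ) - e u|) * x ^ (e (i + 1))
        + |c (i + 2)| * (∏ u ∈ (range n).filter (fun u => u < i ∨ i + 4 ≤ u), |(e (i + 2) : ℝ) - e u|) * x ^ (e (i + 2)) := by
  classical
  set U := (range n).filter (fun u => u < i ∨ i + 4 ≤ u) with hU
  set P : ℕ → ℝ := fun t => ∏ u ∈ U, ((e t : ℝ) - e u) with hP
  have hPabs : ∀ t, |P t| = ∏ u ∈ U, |(e t : ℝ) - e u| := fun t => by rw [hP]; exact Finset.abs_prod _ _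
  obtain ⟨x, hx, hroot⟩ := exists_posRoot_window_four hi e c hZ
  change c i * P i * x ^ e i + c (i + 1) * P (i + 1) * x ^ e (i + 1) + c (i + 2) * P (i + 2) * x ^ e (i + 2)
    + c (i + 3) * P (i + 3) * x ^ e (i + 3) = 0 at hroot
  have hPP03 : 0 < P i * P (i + 3) := prod_kill_mul_prod_kill_pos (w := 4) e he le_rfl (by omega) (by omega) (by omega)
  have hPP12 : 0 < P (i + 1) * P (i + 2) :=
    prod_kill_mul_prod_kill_pos (w := 4) e he (by omega) (by omega) (by omega) (by omega)
  have hc03 : 0 < c i * c (i + 3) := by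
    have h' : 0 < (c i * c (i + 1)) * (c (i + 2) * c (i + 3)) := mul_pos_of_neg_of_neg h1 h3
    nlinarith [h2]
  have hy : ∀ k, 0 < x ^ (e k) := fun k => pow_pos hx _
  have hs1 : 0 < (c i * P i * x ^ e i) * (c (i + 3) * P (i + 3) * x ^ e (i + 3)) := by
    have := mul_pos (mul_pos hc03 hPP03) (mul_pos (hy i) (hy (i + 3)))
    linarith [this]
  have hs2 : 0 < (c (i + 1) * P (i + 1) * x ^ e (i + 1)) * (c (i + 2) * P (i + 2) * x ^ e (i + 2)) := by
    have := mul_pos (mul_pos h2 hPP12) (mul_pos (hy (i + 1)) (hy (i + 2)))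
    linarith [this]
  have heq : c i * P i * x ^ e i + c (i + 3) * P (i + 3) * x ^ e (i + 3)
      = -(c (i + 1) * P (i + 1) * x ^ e (i + 1) + c (i + 2) * P (i + 2) * x ^ e (i + 2)) := by linarith
  have habs := congrArg (fun r : ℝ => |r|) heq
  simp only [abs_neg] at habs
  rw [(abs_add_eq_add_abs_iff _ _).mpr ?_, (abs_add_eq_add_abs_iff _ _).mpr ?_] at habs
  · refine ⟨x, hx, ?_⟩
    rw [← hPabs i, ← hPabs (i + 1), ← hPabs (i + 2), ← hPabs (i + 3)]
    simpa only [abs_mul, abs_of_pos (hy _)] using habs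
  · rcases lt_or_ge 0 (c (i + 1) * P (i + 1) * x ^ e (i + 1)) with h | h
    · exact Or.inl ⟨h.le, by nlinarith⟩
    · exact Or.inr ⟨h, by nlinarith⟩
  · rcases lt_or_ge 0 (c i * P i * x ^ e i) with h | h
    · exact Or.inl ⟨h.le, by nlinarith⟩
    · exact Or.inr ⟨h, by nlinarith⟩

end Summit.ValiantsHypothesis.ValiantsHypothesis.Theorems.LacunarySymmetroidMatrixDescartes.Census
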